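import Summits.AtomisticToContinuum.FouriersLaw.Theses.OddSectorIrreversibility
import Summits.AtomisticToContinuum.FouriersLaw.Theses.BoundaryEscapeDeficit
import Summits.AtomisticToContinuum.FouriersLaw.Theses.JunctionLocality
import Summits.AtomisticToContinuum.FouriersLaw.Theses.FeketeSeriesLaw
import Summits.AtomisticToContinuum.FouriersLaw.Theorems.OddSectorIrreversibilityBoundedResponseConvergesEscapeDeficitForm
import Summits.AtomisticToContinuum.FouriersLaw.Theorems.OddSectorIrreversibilityBoundedResponseConvergesOfSeriesLaw
import Summits.AtomisticToContinuum.FouriersLaw.Theorems.OddSectorIrreversibilityBoundedResponseConvergesKuboLadderBridges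
import Summits.AtomisticToContinuum.FouriersLaw.Theorems.BondHeatUncertaintyPositiveOrInfiniteLimitSlots
import Summits.AtomisticToContinuum.FouriersLaw.Theorems.BondHeatUncertaintyPositiveOrInfiniteLimitSplit
import Summits.AtomisticToContinuum.FouriersLaw.Theorems.OddSectorIrreversibilityBoundedResponseConvergesStubEscapeNonOscillationOfSuperadditive
-- lead c6 (2026-08-17T03Z): summable-defect (de Bruijn–Erdős) series-law bridges (c5-B's kit, p139756/p139881/p139983),
-- the E-form series law (= 12238-birth's hardest stub) ⇒ 14041 ⇒ crux (p140296), positivity of the escape deficit (p140154)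
import Summits.AtomisticToContinuum.FouriersLaw.Theorems.OddSectorIrreversibilityBoundedResponseConvergesSummableDefectSeriesLaw
import Summits.AtomisticToContinuum.FouriersLaw.Theorems.OddSectorIrreversibilityBoundedResponseConvergesOfEscapeResistanceQuasiSubadditive
import Summits.AtomisticToContinuum.FouriersLaw.Theorems.OddSectorIrreversibilityBoundedResponseConvergesStubEscapeDeficitPos
-- lead c18 (2026-08-17T08Z, route affinity MatthiessenLadder): that route's OWN engine for the crux, glued by the landed
-- `MatthiessenLadder.limitGlue_proof` (item 12781): PrefixIncrementLimit (12779) → PrefixSteadyStates (12778) → crux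
import Summits.AtomisticToContinuum.FouriersLaw.Theorems.MatthiessenLadderLimitGlue
-- lead c23 (2026-08-17T13Z, route affinity LocalOhmBV): `PrefixSteadyStates` (12778) is PROVED (12:35Z,
-- `MatthiessenLadderPrefixSteadyStates.PrefixSteadyStates_of`), so `PrefixIncrementLimit` (12779) ALONE now supplies the crux
import Summits.AtomisticToContinuum.FouriersLaw.Theorems.MatthiessenLadderPrefixSteadyStates
-- lead c19 (2026-08-17T08Z, route affinity LocalOhmBV): the route twin `LocalOhmBV.BoundedResponseConverges` (the import
-- slot #4 of that route; LocalOhmBV files NO engine of its own for it) is concluded by the same composition, by name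
import Summits.AtomisticToContinuum.FouriersLaw.Theses.LocalOhmBV
-- Checked against (the landed Negative lane; `#check`ed at the end of the file, not used by the skeleton):
import Summits.AtomisticToContinuum.FouriersLaw.Theorems.BoundedResponseConverges.Negative.LoadBearing

/-!
# Crux `BoundedResponseConverges` (stmt-AtomisticToContinuum-9141) — line `escape-deficit-dichotomy`
# (crux-strategist s1, 2026-08-17; lead c5 02:2x–02:5xZ; lead c6 03:0x–03:13Z; leads c7…c22; owned by lead c23 from 2026-08-17T13:1xZ — delta: 12778 PROVED ⇒ 12779 alone supplies the crux): THE EXACT SPLIT IN SKELETON FORM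

This is the ALTERNATIVE line registered by the crux-strategist seat alongside the live lead (c4, line
`comonotone-local-resistance`, untouched). It is deliberately the thinnest honest skeleton the crux admits
and it is the skeleton form of the DECOMPOSITION the strategist staged for the route
(`route edit --split BoundedResponseConverges --into {EscapeNonOscillation, ConductanceLowerBound}`, children.json +
proved glue `Cruxes/BoundedResponseConverges/SplitGlue.lean`; the gate accepts `--split` only on a seat's FINAL cycle,
so the split is staged, not applied — see `Cruxes/BoundedResponseConverges/SPLIT-PROPOSAL.md`).

WHY THIS SHAPE. After the landed fixed-`N` identities (`responseCoeff_eq_escapeDeficit`: every response coefficient of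
the crux's frame IS `e_N = (N−1)·γ·E_N`, the escape-deficit sequence built from the Gibbs measure and the
equal-temperature kernels only) the crux has NO fixed-`N` content left: it is the large-`N` behaviour of ONE explicit
equilibrium real sequence per parameter point, and its two printed failure modes (its own `why it might fail`,
BLR2000 §6.3; `Negative/LoadBearing`: `boundedResponseConverges_skeleton_oscillating` / `_insulating`) are two
EXISTING typed items of sibling routes:

* `stub_escapeNonOscillation` = `BoundaryEscapeDeficit.EscapeNonOscillation` (stmt-12238) BY NAME — `N ↦ (N−1)γE_N`
  has a limit in `EReal` (liminf = limsup; no value, no sign, no boundedness claimed): OSCILLATION EXCLUDED;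
* `stub_conductanceFloor` = `JunctionLocality.ConductanceLowerBound` (stmt-11749) BY NAME — `D_N ≥ c > 0` eventually:
  INSULATION EXCLUDED (live line elsewhere: `cold-bath-relocation-walk`, lead 11749-c2, one stub `stub_bulkStep_resolvent`
  left, p136370).

`BoundedResponseConverges_of` composes them to the crux BY NAME: the `EReal` limit of `e_N` is an `EReal` limit of
`D` (they agree for `N ≥ 1`), the crux's OWN `BddAbove (range |D|)` caps it, the floor bounds it below, so it is a real
number `k ≥ c > 0` and `D_N → k`. Both stubs are strictly weaker than the crux; granted the route's sibling item
`BoundedResponse` (10924) the crux implies both (`stubs_of_boundedResponse_of_crux` below, by name over landed bridges):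
the stub set is jointly EQUIVALENT to the crux on this route — no slack is introduced and none is hidden.

SUPPLY MAPS (all sorry-free, by name, below): stub 1 ⇐ `JunctionLocality.SuperadditiveResistance` (11748) ALONE (lead c5,
p138689: `EReal` trichotomy, no boundedness) ⇐/or `FeketeSeriesLaw.QuasiSubadditiveResistance` (14041, Fekete with
additive defect) ⇐/or the Kubo-value ladder (landed `escapeNonOscillation_of_kuboLadder`) ⇐/or `BoundaryEscapeDeficit.EscapeLaw`
(12234); stub 2 ⇐ the sibling slot `PositiveOrInfiniteLimit` (9128) ⇐ 14041, and ⇐ `JunctionLocality` / `ContactStieltjesMeasure` /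
`StaticAbelianSqueeze` / `LogConcaveRigidity` lines (wanted_by of 11749). Any ONE of 14041, 12234, the ladder closes stub 1
by a one-line `--supports` file; any proof of 11749 closes stub 2 likewise.

WHY IT DODGES THE STUCK GOALS OF THE LIVE LINE. The live line's S1–S3 are `N`-uniform SHAPE statements about the spatially
resolved response profile (all shadows of `LocalFourierLaw` 13406, strictly stronger than what the crux needs; S2's
hard-wired sign already needed slack at depths 0–1, numerics-c3). This line asks for NO profile information, NO sign, NO
monotonicity and NO rate: stub 1 is bare `EReal`-regularity of one scalar sequence (true with limit `⊤` at the harmonic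
corner, where only `BddAbove` blocks the conclusion — `boundedResponseConverges_false_without_bddAbove_harmonic` honoured:
`BddAbove` is consumed in `exists_pos_tendsto_of_ereal_tendsto_of_abs_le_of_floor`), stub 2 is the floor every
bounded-response line needs anyway (`conductanceLowerBound_of_boundedResponseConverges`, Disproof kill criteria). It does
not make the mathematics easier — nothing short of an `N`-uniform relaxation input does (crux NOTES "common diagnosis") —
it makes the TARGETS minimal and by-name, so that progress on 12238 / 11749 / 14041 / 12234 anywhere in the tree lands here
with zero glue.
-/

noncomputable section

namespace Summit.AtomisticToContinuum.FouriersLaw.Cruxes.BoundedResponseConverges.EscapeDeficitDichotomy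

open MeasureTheory Filter Topology Set
open Literature.MathematicalPhysics.KineticTheory.HeatConduction
open Summit.AtomisticToContinuum.FouriersLaw.Theses
open Summit.AtomisticToContinuum.FouriersLaw.Theorems

/-! ## The two stubs (`sorry` lives only here; both are EXISTING route items by name) -/

/-- **Stub 1 · escapeNonOscillation — OSCILLATION EXCLUDED** (= `BoundaryEscapeDeficit.EscapeNonOscillation`,
stmt-AtomisticToContinuum-12238, verbatim by name): for all parameters `> 0` and `T > 0` the escape-deficit sequence
`N ↦ (N−1)·γ·E_N` (`E_N = 1 − (γ/T²)∫₀^∞ K_N`, `K_N(u) = ∫ (p₀² − T)·P_u(p₀² − T) dμ_T`) has a limit in `EReal`.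
HARDEST stub of the line (size L, open: bare regularity in the length; engines = quasi-subadditivity of `1/(γE_N)`
(14041), the Kubo ladder, or the full escape law 12234 — see the supply maps below). Harmonic corner: holds with limit `⊤`. -/
theorem stub_escapeNonOscillation : BoundaryEscapeDeficit.EscapeNonOscillation := by
  sorry

/-- **Stub 2 · conductanceFloor — INSULATION EXCLUDED** (= `JunctionLocality.ConductanceLowerBound`,
stmt-AtomisticToContinuum-11749, verbatim by name): under weak-NESS uniqueness, along every steady-state family and
`T > 0`, the response coefficients satisfy `D_N ≥ c > 0` for `N ≥ N₁`. Size XL (no `N`-uniform lower bound on the NESS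
current of a deterministic anharmonic chain is in print); staffed elsewhere (wanted_by: JunctionLocality r4,
ContactStieltjesMeasure r5, StaticAbelianSqueeze r6, LogConcaveRigidity, ParityLiouvilleSeed). Harmonic corner: holds
(`D_N → ∞`). -/
theorem stub_conductanceFloor : JunctionLocality.ConductanceLowerBound := by
  sorry

/-! ## Proved glue: the `EReal` squeeze (pure real analysis) -/

/-- A real sequence whose `EReal` image converges, bounded in absolute value and eventually above a positive floor `c`,
converges in `ℝ` to some `k > 0`. [folklore] -/
theorem exists_pos_tendsto_of_ereal_tendsto_of_abs_le_of_floor (D : ℕ → ℝ) {ℓ : EReal}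
    (hℓ : Tendsto (fun N : ℕ => ((D N : ℝ) : EReal)) atTop (𝓝 ℓ))
    {B : ℝ} (hB : ∀ N, |D N| ≤ B) {c : ℝ} (hc : 0 < c) {N₁ : ℕ} (hfloor : ∀ N, N₁ ≤ N → c ≤ D N) :
    ∃ k : ℝ, 0 < k ∧ Tendsto D atTop (𝓝 k) := by
  have hℓ_le : ℓ ≤ ((B : ℝ) : EReal) :=
    le_of_tendsto' hℓ fun N => EReal.coe_le_coe_iff.2 ((le_abs_self _).trans (hB N))
  have hev : ∀ᶠ N : ℕ in atTop, ((c : ℝ) : EReal) ≤ ((D N : ℝ) : EReal) :=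
    (eventually_ge_atTop N₁).mono fun N hN => EReal.coe_le_coe_iff.2 (hfloor N hN)
  have hℓ_ge : ((c : ℝ) : EReal) ≤ ℓ := ge_of_tendsto hℓ hev
  have hℓ_top : ℓ ≠ ⊤ := ne_top_of_le_ne_top (EReal.coe_ne_top _) hℓ_le
  have hℓ_bot : ℓ ≠ ⊥ := ne_bot_of_le_ne_bot (EReal.coe_ne_bot _) hℓ_ge
  refine ⟨ℓ.toReal, ?_, ?_⟩
  · rw [← EReal.coe_toReal hℓ_top hℓ_bot, EReal.coe_le_coe_iff] at hℓ_ge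
    exact lt_of_lt_of_le hc hℓ_ge
  · rw [← EReal.coe_toReal hℓ_top hℓ_bot] at hℓ
    exact EReal.tendsto_coe.1 hℓ

/-- **The glue as a closed implication** (= the split glue `boundedResponseConverges_of_subs` of `SplitGlue.lean`):
non-oscillation of the escape deficit + the conductance floor ⇒ the crux, BY NAME. Uses the crux's own `BddAbove`
(upper cap of the squeeze) and weak-NESS uniqueness (inside `responseCoeff_eq_escapeDeficit`). [folklore] -/
theorem boundedResponseConverges_of_stubs
    (hNO : BoundaryEscapeDeficit.EscapeNonOscillation) (hF : JunctionLocality.ConductanceLowerBound) :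
    OddSectorIrreversibility.BoundedResponseConverges := by
  intro ω₂ lam β γ hω hl hβ hγ hU μ hμ T hT D hD hbdd
  obtain ⟨c, hc, N₁, hfloor⟩ := hF ω₂ lam β γ hω hl hβ hγ hU μ hμ T hT D hD
  have h := hNO ω₂ lam β γ hω hl hβ hγ T hT
  dsimp only at h
  obtain ⟨ℓ, hℓ⟩ := h
  -- the `EReal` limit of `e_N` is an `EReal` limit of `D` (they agree for `N ≥ 1`)
  have hℓD : Tendsto (fun N : ℕ => ((D N : ℝ) : EReal)) atTop (𝓝 ℓ) := by
    refine hℓ.congr' ?_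
    filter_upwards [eventually_gt_atTop 0] with N hN
    rw [EReal.coe_eq_coe_iff, responseCoeff_eq_escapeDeficit hω hl hβ hγ hU μ hμ hT hN (hD N)]
    simp only [dif_pos hN]
  obtain ⟨B, hB⟩ := hbdd
  have hB' : ∀ N, |D N| ≤ B := fun N => hB ⟨N, rfl⟩
  exact exists_pos_tendsto_of_ereal_tendsto_of_abs_le_of_floor D hℓD hB' hc hfloor

/-! ## The composition: the two stubs imply the crux BY NAME (registered skeleton theorem) -/

/-- **Registered composition.** `stub_escapeNonOscillation` and `stub_conductanceFloor` ALONE give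
`OddSectorIrreversibility.BoundedResponseConverges`; the only `sorry`s of the file are the two stubs. -/
theorem BoundedResponseConverges_of : OddSectorIrreversibility.BoundedResponseConverges :=
  boundedResponseConverges_of_stubs stub_escapeNonOscillation stub_conductanceFloor

/-! ## Exactness: granted `BoundedResponse` (10924) the crux gives both stubs back (no hidden slack) -/

/-- Granted the route's sibling item `OddSectorIrreversibility.BoundedResponse` (stmt-10924), the crux implies stub 1
(by name: crux ∧ bounded response ⇒ the sibling slot 9128 ⇒ 12238, fed with the PROVED `NessUnique_holds` and
`responseIdentity_proof`). [folklore] -/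
theorem stub_escapeNonOscillation_of_boundedResponse_of_crux
    (hB : OddSectorIrreversibility.BoundedResponse) (hC : OddSectorIrreversibility.BoundedResponseConverges) :
    BoundaryEscapeDeficit.EscapeNonOscillation :=
  PositiveOrInfiniteLimit.escapeNonOscillation_of_positiveOrInfiniteLimit
    OddSectorIrreversibility.NessUnique_holds
    Summit.AtomisticToContinuum.FouriersLaw.Cruxes.SuperadditiveResistance.ThermaliseThenCutProbeInsertion.responseIdentity_proof
    (PositiveOrInfiniteLimit.positiveOrInfiniteLimit_of_boundedResponseConverges hC hB)

/-- Granted `BoundedResponse` (10924), the crux implies stub 2 (crux ∧ bounded response ⇒ 9128 ⇒ 11749). [folklore] -/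
theorem stub_conductanceFloor_of_boundedResponse_of_crux
    (hB : OddSectorIrreversibility.BoundedResponse) (hC : OddSectorIrreversibility.BoundedResponseConverges) :
    JunctionLocality.ConductanceLowerBound :=
  PositiveOrInfiniteLimit.conductanceLowerBound_of_positiveOrInfiniteLimit
    (PositiveOrInfiniteLimit.positiveOrInfiniteLimit_of_boundedResponseConverges hC hB)

/-! ## Supply maps for the stubs (sorry-free, by name over landed bridges) -/

/-- **Stub 1 ⇐ `FeketeSeriesLaw.QuasiSubadditiveResistance` (stmt-14041)**: quasi-subadditivity of the resistance gives,
by Fekete with additive defect (landed `feketeGlue_holds`) and the landed positivity `D_N > 0` (`N ≥ 2`), an `EReal` limit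
`ℓ ∈ (0, ⊤]` of `D` along every family (= the sibling slot 9128), hence the `EReal`-regularity of the escape deficit. -/
theorem stub_escapeNonOscillation_of_quasiSubadditiveResistance
    (hS : FeketeSeriesLaw.QuasiSubadditiveResistance) : BoundaryEscapeDeficit.EscapeNonOscillation :=
  PositiveOrInfiniteLimit.escapeNonOscillation_of_positiveOrInfiniteLimit
    OddSectorIrreversibility.NessUnique_holds
    Summit.AtomisticToContinuum.FouriersLaw.Cruxes.SuperadditiveResistance.ThermaliseThenCutProbeInsertion.responseIdentity_proof
    (TwoScaleGluingLogRigidity.Stubs.positiveOrInfiniteLimit_of_quasiSubadditiveResistance hS)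

/-- **Stub 1 ⇐ `JunctionLocality.SuperadditiveResistance` (stmt-11748) ALONE** (lead c5, landed p138689
`EscapeDeficitDichotomy.escapeNonOscillation_of_superadditiveResistance`): quasi-SUPERadditivity of the resistance gives,
by Fekete on `{n ≥ 2}` and the landed positivity, an `EReal` TRICHOTOMY `0 / k / ⊤` for `D` along every family — no
boundedness and no floor needed — hence the `EReal`-regularity of the escape deficit. With the landed
`boundedResponseConverges_of_junctionLocality` (11748 ∧ 11749 ⇒ crux, p103088): granted 11748, only stub 2 remains. -/
theorem stub_escapeNonOscillation_of_superadditiveResistance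
    (hA : JunctionLocality.SuperadditiveResistance) : BoundaryEscapeDeficit.EscapeNonOscillation :=
  EscapeDeficitDichotomy.escapeNonOscillation_of_superadditiveResistance hA

-- **Stub 1 ⇐ the Kubo-value ladder** (either branch of the dichotomy of line `ohmic-floor-monotone-ladder`) is the
-- landed theorem `OhmicFloorMonotoneLadder.Stubs.escapeNonOscillation_of_kuboLadder` (KuboLadderBridges, p103089):
#check @OhmicFloorMonotoneLadder.Stubs.escapeNonOscillation_of_kuboLadder

/-- **Stub 1 ⇐ `BoundaryEscapeDeficit.EscapeLaw` (stmt-12234)**: a real positive limit is in particular an `EReal`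
limit (the two `let`-bound sequences are syntactically the same). [folklore] -/
theorem stub_escapeNonOscillation_of_escapeLaw (hE : BoundaryEscapeDeficit.EscapeLaw) :
    BoundaryEscapeDeficit.EscapeNonOscillation := by
  intro ω₂ lam β γ hω hl hβ hγ T hT
  have h := hE ω₂ lam β γ hω hl hβ hγ T hT
  dsimp only at h ⊢
  obtain ⟨κb, -, hlim⟩ := h
  exact ⟨((κb : ℝ) : EReal), (continuous_coe_real_ereal.tendsto _).comp hlim⟩

/-- **Stub 2 ⇐ the sibling slot `PositiveOrInfiniteLimit` (stmt-9128)** (landed necessity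
`conductanceLowerBound_of_positiveOrInfiniteLimit`), hence stub 2 ⇐ 14041 as well. -/
theorem stub_conductanceFloor_of_positiveOrInfiniteLimit (hL : BondHeatUncertainty.PositiveOrInfiniteLimit) :
    JunctionLocality.ConductanceLowerBound :=
  PositiveOrInfiniteLimit.conductanceLowerBound_of_positiveOrInfiniteLimit hL

/-- Stub 2 ⇐ 14041 (through 9128). -/
theorem stub_conductanceFloor_of_quasiSubadditiveResistance (hS : FeketeSeriesLaw.QuasiSubadditiveResistance) :
    JunctionLocality.ConductanceLowerBound :=
  PositiveOrInfiniteLimit.conductanceLowerBound_of_positiveOrInfiniteLimit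
    (TwoScaleGluingLogRigidity.Stubs.positiveOrInfiniteLimit_of_quasiSubadditiveResistance hS)

/-! ## Supply maps landed by lead c6 (2026-08-17T03Z): equilibrium (E-form) series law; summable junction defect

Item 12238's birth skeleton (`Cruxes/EscapeNonOscillation/Lines/birth.lean`, registered 02:48Z) reduces stub 1 to two
EQUILIBRIUM stubs about the escape deficit `E_N`: `stub_escapeDeficitPos` (`E_N > 0`, `N ≥ 2`) and
`stub_resistanceQuasiSubadditive` (`∃ C, ∀ n m ≥ 2, 1/(γE_{n+m}) ≤ 1/(γE_n) + 1/(γE_m) + C`). From this seat: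
the first is PROVED (`EscapeDeficitDichotomy.stub_escapeDeficitPos`, p140154 — by-signature the birth stub), and the second
ALONE closes not only stub 1 but THE CRUX and stub 2 (`…_of_escapeResistanceQuasiSubadditive`, p140296: E-form ⇒ 14041's
statement along every family, by `resistance_eq_inv_escape : (K−1)/D K = 1/(γE_K)`). Lead c5-B's summable-defect Fekete
(de Bruijn–Erdős; p139756/p139881/p139983) relaxes every bounded junction defect `C` above to any `φ ≥ 0` monotone with
`Σ φ(2^k)/2^k < ∞`. -/

/-- **Stub 1 ⇐ the E-form series law** (= 12238-birth's `stub_resistanceQuasiSubadditive`, verbatim up to qualification):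
quasi-subadditivity of the equilibrium resistance `1/(γE_N)` gives 14041's statement along every steady family (p140296),
hence stub 1 (through 9128). [folklore] -/
theorem stub_escapeNonOscillation_of_escapeResistanceQuasiSubadditive
    (hQ : ∀ ω₂ lam β γ : ℝ, 0 < ω₂ → 0 < lam → 0 < β → 0 < γ → ∀ T : ℝ, 0 < T → ∀ E : ℕ → ℝ,
      (∀ N : ℕ, E N = 1 - γ / T ^ 2 * ∫ u in Set.Ioi (0 : ℝ),
          (if h : 0 < N then
              ∫ z, ((z.2 ⟨0, h⟩) ^ 2 - T) * (∫ y, ((y.2 ⟨0, h⟩) ^ 2 - T)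
                ∂((pinnedChain ω₂ lam β γ).transitionKernel N T T u.toNNReal z))
                ∂((pinnedChain ω₂ lam β γ).gibbsMeasure N T)
            else 0)) →
        ∃ C : ℝ, ∀ n m : ℕ, 2 ≤ n → 2 ≤ m → 1 / (γ * E (n + m)) ≤ 1 / (γ * E n) + 1 / (γ * E m) + C) :
    BoundaryEscapeDeficit.EscapeNonOscillation :=
  stub_escapeNonOscillation_of_quasiSubadditiveResistance
    (EscapeDeficitDichotomy.quasiSubadditiveResistance_of_escapeResistanceQuasiSubadditive hQ)

/-- **Stub 2 ⇐ the E-form series law** (p140296, through 9128). [folklore] -/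
theorem stub_conductanceFloor_of_escapeResistanceQuasiSubadditive
    (hQ : ∀ ω₂ lam β γ : ℝ, 0 < ω₂ → 0 < lam → 0 < β → 0 < γ → ∀ T : ℝ, 0 < T → ∀ E : ℕ → ℝ,
      (∀ N : ℕ, E N = 1 - γ / T ^ 2 * ∫ u in Set.Ioi (0 : ℝ),
          (if h : 0 < N then
              ∫ z, ((z.2 ⟨0, h⟩) ^ 2 - T) * (∫ y, ((y.2 ⟨0, h⟩) ^ 2 - T)
                ∂((pinnedChain ω₂ lam β γ).transitionKernel N T T u.toNNReal z))
                ∂((pinnedChain ω₂ lam β γ).gibbsMeasure N T)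
            else 0)) →
        ∃ C : ℝ, ∀ n m : ℕ, 2 ≤ n → 2 ≤ m → 1 / (γ * E (n + m)) ≤ 1 / (γ * E n) + 1 / (γ * E m) + C) :
    JunctionLocality.ConductanceLowerBound :=
  EscapeDeficitDichotomy.conductanceLowerBound_of_escapeResistanceQuasiSubadditive hQ

-- **The crux ⇐ the E-form series law directly** (p140296) and **⇐ a summable-defect subadditive law** (p139983);
-- **stub 1 ⇐ a summable-defect SUPERadditive law** (p139983, generalising p138689); positivity of `E_N` (p140154):
#check @EscapeDeficitDichotomy.boundedResponseConverges_of_escapeResistanceQuasiSubadditive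
#check @EscapeDeficitDichotomy.boundedResponseConverges_of_summableDefect_subadditive
#check @EscapeDeficitDichotomy.escapeNonOscillation_of_summableDefect_superadditive
#check @EscapeDeficitDichotomy.escapeNonOscillation_of_responseRegular
#check @EscapeDeficitDichotomy.stub_escapeDeficitPos

/-! ## Supply map from route `MatthiessenLadder`'s own engine (lead c18, 2026-08-17T08Z)

The fourth route wanting the crux (`MatthiessenLadder`, this seat's route affinity) files its OWN engine for the slot:
Matthiessen's rule proper `MatthiessenLadder.PrefixIncrementLimit` (stmt-AtomisticToContinuum-12779: bulk resistance
increments of the prefix ladder `cellChain (· < k)` converge to `r > 0`, all increments `≤ rmax`) over the rungs' frame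
`MatthiessenLadder.PrefixSteadyStates` (stmt-AtomisticToContinuum-12778), glued by the LANDED telescoping/Cesàro theorem
`Theorems.MatthiessenLadder.limitGlue_proof` (item 12781; it uses neither weak-NESS uniqueness nor the slot's `BddAbove`).
The two route twins of the crux are syntactically identical `def`s, so the glue closes THIS skeleton's target by name:
12779 ∧ 12778 is a third complete supplier pair (both open 2026-08-17T07:5xZ; 12779 is rated `open-problem` and is
strictly MORE than the crux — it gives `D_N → 1/r` with no boundedness hypothesis, i.e. Fourier's clause (ii) outright). -/

/-- **The crux ⇐ `MatthiessenLadder.PrefixIncrementLimit` ∧ `MatthiessenLadder.PrefixSteadyStates`** (stmt-12779 ∧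
stmt-12778), by the landed `limitGlue_proof` (stmt-12781); the route twin `MatthiessenLadder.BoundedResponseConverges`
unfolds to the same statement as `OddSectorIrreversibility.BoundedResponseConverges`. [folklore] -/
theorem boundedResponseConverges_of_prefixIncrementLimit
    (hL : Summit.AtomisticToContinuum.FouriersLaw.Theses.MatthiessenLadder.PrefixIncrementLimit)
    (hS : Summit.AtomisticToContinuum.FouriersLaw.Theses.MatthiessenLadder.PrefixSteadyStates) :
    OddSectorIrreversibility.BoundedResponseConverges :=
  Summit.AtomisticToContinuum.FouriersLaw.Theorems.MatthiessenLadder.limitGlue_proof hL hS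

/-! ## The route twin of `LocalOhmBV` (lead c19, 2026-08-17T08Z)

Route `LocalOhmBV` (this seat's route affinity) carries the crux as its import slot #4, verbatim: its own cruxes `LocalOhm`
(#2) and `BVProfile` (#3) deliver `BoundedResponse` (10924) through the landed `localOhmGlue_proof`, and NOTHING in that
route bears on convergence — so there is no LocalOhmBV supply map to add; the route is served by the same two stubs.
The twin `def` is syntactically identical to `OddSectorIrreversibility.BoundedResponseConverges`, so the registered
composition concludes it by definitional unfolding. -/

/-- **Registered composition, LocalOhmBV twin.** The two stubs give `LocalOhmBV.BoundedResponseConverges` by name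
(the two route decls unfold to the same statement). [folklore] -/
theorem BoundedResponseConverges_localOhmBV_of : LocalOhmBV.BoundedResponseConverges :=
  BoundedResponseConverges_of

/-- The split glue for the LocalOhmBV twin as a closed implication: 12238 ∧ 11749 ⇒ the LocalOhmBV slot. [folklore] -/
theorem boundedResponseConverges_localOhmBV_of_stubs
    (hNO : BoundaryEscapeDeficit.EscapeNonOscillation) (hF : JunctionLocality.ConductanceLowerBound) :
    LocalOhmBV.BoundedResponseConverges :=
  boundedResponseConverges_of_stubs hNO hF

/-! ## The route twin of `MatthiessenLadder` (lead c20, 2026-08-17T09Z)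

Route `MatthiessenLadder` carries the crux as its import slot #5, verbatim; unlike `LocalOhmBV` it ALSO files an engine of
its own for the slot — Matthiessen's rule proper, `PrefixIncrementLimit` (12779) over `PrefixSteadyStates` (12778), glued by
the landed `limitGlue_proof` (`boundedResponseConverges_of_prefixIncrementLimit` above). The twin `def` is syntactically
identical to `OddSectorIrreversibility.BoundedResponseConverges`, so the registered composition concludes it by definitional
unfolding, and the route's own engine concludes it by name. (Lead c20 also ran the strategists' staged
`route edit route-AtomisticToContinuum-MatthiessenLadder --split BoundedResponseConverges --glue-by boundedResponseConverges_of_subs`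
from this seat: refused, "only the route's planner (lease unit = this route, or its opener) or the operator may revise it" —
the split stays staged for a route-holder, `Cruxes/BoundedResponseConverges/SPLIT-PROPOSAL-s2.md`.) -/

/-- **Registered composition, MatthiessenLadder twin.** The two stubs give `MatthiessenLadder.BoundedResponseConverges`
by name (the two route decls unfold to the same statement). [folklore] -/
theorem BoundedResponseConverges_matthiessenLadder_of :
    Summit.AtomisticToContinuum.FouriersLaw.Theses.MatthiessenLadder.BoundedResponseConverges :=
  BoundedResponseConverges_of

/-- The split glue for the MatthiessenLadder twin as a closed implication: 12238 ∧ 11749 ⇒ the MatthiessenLadder slot.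
[folklore] -/
theorem boundedResponseConverges_matthiessenLadder_of_stubs
    (hNO : BoundaryEscapeDeficit.EscapeNonOscillation) (hF : JunctionLocality.ConductanceLowerBound) :
    Summit.AtomisticToContinuum.FouriersLaw.Theses.MatthiessenLadder.BoundedResponseConverges :=
  boundedResponseConverges_of_stubs hNO hF

/-- The MatthiessenLadder slot from the route's OWN engine, by name: `PrefixIncrementLimit` (12779) ∧
`PrefixSteadyStates` (12778) ⇒ `MatthiessenLadder.BoundedResponseConverges` (the landed `limitGlue_proof`, stmt-12781,
is literally this implication). [folklore] -/
theorem boundedResponseConverges_matthiessenLadder_of_prefixIncrementLimit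
    (hL : Summit.AtomisticToContinuum.FouriersLaw.Theses.MatthiessenLadder.PrefixIncrementLimit)
    (hS : Summit.AtomisticToContinuum.FouriersLaw.Theses.MatthiessenLadder.PrefixSteadyStates) :
    Summit.AtomisticToContinuum.FouriersLaw.Theses.MatthiessenLadder.BoundedResponseConverges :=
  Summit.AtomisticToContinuum.FouriersLaw.Theorems.MatthiessenLadder.limitGlue_proof hL hS

/-! ## Supply map after the landing of `PrefixSteadyStates` (lead c23, 2026-08-17T13Z)

Item stmt-AtomisticToContinuum-12778 `MatthiessenLadder.PrefixSteadyStates` was CLOSED `proved` at 2026-08-17T12:35Z by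
`Summit.AtomisticToContinuum.FouriersLaw.Theorems.MatthiessenLadderPrefixSteadyStates.PrefixSteadyStates_of` (line lead
12778-c3: CEHR Thm 5.1 for the mixed rungs, fourteen landed stubs). Consequently the MatthiessenLadder supply pair
12779 ∧ 12778 of lead c18 collapses to ONE open antecedent: `MatthiessenLadder.PrefixIncrementLimit` (stmt-12779, Matthiessen's
rule proper; rated open-problem — it yields Fourier's clause (ii) outright, with no boundedness hypothesis) ALONE implies the
crux and all three of its route twins, by the landed `limitGlue_proof`. This is the first change of the crux's by-name supplier
web since lead c6 (03:13Z): the complete list of SINGLE sufficient open antecedents is now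
{14041, E-form series law (12238-birth stub 2), summable-defect series law, 13406, Kubo ladder, 12234, 12779} and the pairs
{12238 ∧ 11749 (registered stubs), 11748 ∧ 11749}. -/

/-- **The crux ⇐ `MatthiessenLadder.PrefixIncrementLimit` ALONE** (stmt-12779): the frame `PrefixSteadyStates` (stmt-12778)
of the prefix ladder is now a theorem (`PrefixSteadyStates_of`), so the landed telescoping/Cesàro glue `limitGlue_proof`
(stmt-12781) turns Matthiessen's rule proper into the crux with no further hypothesis. [folklore] -/
theorem boundedResponseConverges_of_prefixIncrementLimit_alone
    (hL : Summit.AtomisticToContinuum.FouriersLaw.Theses.MatthiessenLadder.PrefixIncrementLimit) :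
    OddSectorIrreversibility.BoundedResponseConverges :=
  Summit.AtomisticToContinuum.FouriersLaw.Theorems.MatthiessenLadder.limitGlue_proof hL
    Summit.AtomisticToContinuum.FouriersLaw.Theorems.MatthiessenLadderPrefixSteadyStates.PrefixSteadyStates_of

/-- Stub 1 ⇐ 12779 alone, granted the sibling `BoundedResponse` (10924): through the crux and the exactness of the split.
[folklore] -/
theorem stub_escapeNonOscillation_of_prefixIncrementLimit_of_boundedResponse
    (hL : Summit.AtomisticToContinuum.FouriersLaw.Theses.MatthiessenLadder.PrefixIncrementLimit)
    (hB : OddSectorIrreversibility.BoundedResponse) : BoundaryEscapeDeficit.EscapeNonOscillation :=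
  stub_escapeNonOscillation_of_boundedResponse_of_crux hB (boundedResponseConverges_of_prefixIncrementLimit_alone hL)

/-- Stub 2 ⇐ 12779 alone, granted the sibling `BoundedResponse` (10924). [folklore] -/
theorem stub_conductanceFloor_of_prefixIncrementLimit_of_boundedResponse
    (hL : Summit.AtomisticToContinuum.FouriersLaw.Theses.MatthiessenLadder.PrefixIncrementLimit)
    (hB : OddSectorIrreversibility.BoundedResponse) : JunctionLocality.ConductanceLowerBound :=
  stub_conductanceFloor_of_boundedResponse_of_crux hB (boundedResponseConverges_of_prefixIncrementLimit_alone hL)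

/-- **LocalOhmBV twin ⇐ 12779 alone** (this seat's route affinity; the twin unfolds to the same statement). [folklore] -/
theorem boundedResponseConverges_localOhmBV_of_prefixIncrementLimit_alone
    (hL : Summit.AtomisticToContinuum.FouriersLaw.Theses.MatthiessenLadder.PrefixIncrementLimit) :
    LocalOhmBV.BoundedResponseConverges :=
  boundedResponseConverges_of_prefixIncrementLimit_alone hL

/-- **MatthiessenLadder twin ⇐ 12779 alone** (that route's own engine, its frame now discharged). [folklore] -/
theorem boundedResponseConverges_matthiessenLadder_of_prefixIncrementLimit_alone
    (hL : Summit.AtomisticToContinuum.FouriersLaw.Theses.MatthiessenLadder.PrefixIncrementLimit) :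
    Summit.AtomisticToContinuum.FouriersLaw.Theses.MatthiessenLadder.BoundedResponseConverges :=
  boundedResponseConverges_of_prefixIncrementLimit_alone hL

/-! ## Disproof used: the landed Negative lane the stub set is checked against

`boundedResponseConverges_false_without_bddAbove_harmonic` — honoured: `BddAbove` is consumed in the squeeze
(`exists_pos_tendsto_of_ereal_tendsto_of_abs_le_of_floor`, hypothesis `hB`); at the harmonic corner both stubs HOLD
(stub 1 with limit `⊤`, stub 2 with `D_N → ∞`) and only `BddAbove` fails, as it must.
`boundedResponseConverges_false_without_unique_gamma_zero` — honoured: uniqueness is consumed by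
`responseCoeff_eq_escapeDeficit` (identification `D_N = e_N`) and is a hypothesis of stub 2's frame.
`boundedResponseConverges_skeleton_oscillating` is excluded by stub 1, `boundedResponseConverges_skeleton_insulating` by
stub 2 — one Negative lemma per stub, neither stub an instance of a refuted statement (negatives index: no FouriersLaw
entry of either shape). -/
#check @boundedResponseConverges_false_without_bddAbove_harmonic
#check @boundedResponseConverges_false_without_unique_gamma_zero
#check @boundedResponseConverges_skeleton_oscillating
#check @boundedResponseConverges_skeleton_insulating

end Summit.AtomisticToContinuum.FouriersLaw.Cruxes.BoundedResponseConverges.EscapeDeficitDichotomy
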